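import Mathlib
import Summits.PneNP.PneNP.Theorems.SfmBlSpotPackage
import Summits.PneNP.PneNP.Theorems.SfmBlExistsAux

/-!
# Parametric packages for the machine closer of the line «sfm-bl» (explicit `ê`, free `ℓ`, `t₀`)

FRONTIER F-N1c; nothing here bears on P vs NP.

`SfmBlSpotPackage.spot_package` hides the spot's `ê` behind an `∃`, and `SfmBlExistsAux.remainder_package`
fixes the astronomically large walk length `ℓ = 2^{N+6}` — both fine for the EXISTENCE theorem
(`SfmBlExistsCertified.exists_cutCertified`) but not for an ALGORITHM, which must compute `ê` and use
`ℓ, t₀ = O(log N)`.  This file gives the parametric twins consumed by `SfmBlPipeline.cutCertified_of_pipeline`: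

* `spot_package_explicit` — the families `𝒲` (connected pairs inside the spot) and `bad T` are supplied by the
  caller as `Finset`s with MEMBERSHIP characterisations only (so any decidable / integer implementation, e.g.
  via `sfmBl_bad_iff_int`, plugs in), and the two conclusions of `spot_package` are stated for the explicit
  `ê(T) = Σ_{W ∈ bad T} #{legs meeting W}`.
* `remainder_package_param` — Prop. 7 + numerics with FREE half-exponent `k`, size bound `b` and threshold
  `t₀` under the side conditions `N ≤ 2^b`, `2k + 2b ≤ 10(t₀+1)`, `20N ≤ 2^k`, and with `ρ_R` replaced by its
  RATIONAL bound `2^60/20`: `A₁ := 10(N·(2^60/20)^{2k} + 1) ≤ (√2·2^60/20)^{2k}`,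
  `Σ_T tr(A_T^{2k}) ≤ 2^m·A₁/10`, `N·(√2·2^60/20)/2 ≤ 0.32·m`.
-/

namespace Summit.PneNP.PneNP.Theorems.SfmBl

open Matrix Finset BigOperators
open Summit.PneNP.PneNP.Theorems.CandCutNorm

/-- **SPOT PACKAGE, EXPLICIT FORM** (see the module docstring). -/
theorem spot_package_explicit {α β E : Type} [Fintype α] [Fintype β] [DecidableEq α] [DecidableEq β]
    [Fintype E] {m : ℕ} (src : E → α) (dst : E → β) (out : E → Fin m)
    (V₁ : Finset α) (V₂ : Finset β) (hE : ∀ e, src e ∈ V₁ ∧ dst e ∈ V₂)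
    (hout : ∀ j : Fin m, (Finset.univ.filter fun e => out e = j).card ≤ 3)
    {Lₙ : ℕ} (hLₙ : 0 < Lₙ) (hdeg₁ : ∀ i, (Finset.univ.filter fun e => src e = i).card ≤ Lₙ)
    (hdeg₂ : ∀ k, (Finset.univ.filter fun e => dst e = k).card ≤ Lₙ)
    (hLₙ2 : 2 ≤ (Lₙ : ℝ)) {γ' : ℝ} (hγ' : 0 ≤ γ') (hγ'L : 144 * (Lₙ : ℝ) * Real.log Lₙ ≤ γ' ^ 2)
    (hdense : 60 * γ' * Real.sqrt ((V₁.card : ℝ) * (V₂.card : ℝ)) < Fintype.card E)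
    (M : (Fin m → Bool) → Matrix α β ℝ)
    (hM : ∀ T i k, M T i k = ∑ e ∈ Finset.univ.filter (fun e => src e = i ∧ dst e = k),
      ((boolSign (T (out e)) : ℤ) : ℝ))
    (𝒲 : Finset (Finset α × Finset β))
    (h𝒲 : ∀ W, W ∈ 𝒲 ↔ W.1 ⊆ V₁ ∧ W.2 ⊆ V₂ ∧
      IsConnectedPair (fun i k => ∃ e, src e = i ∧ dst e = k) W.1 W.2)
    (bad : (Fin m → Bool) → Finset (Finset α × Finset β))
    (hbad : ∀ T W, W ∈ bad T ↔ W ∈ 𝒲 ∧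
      γ' * Real.sqrt ((W.1.card : ℝ) * (W.2.card : ℝ)) < |∑ i ∈ W.1, ∑ k ∈ W.2, M T i k|) :
    (∀ (T : Fin m → Bool) (σ : α → ℝ) (φ : β → ℝ), (∀ i, σ i = 1 ∨ σ i = -1) →
        (∀ k, φ k = 1 ∨ φ k = -1) → σ ⬝ᵥ (M T *ᵥ φ) < (Fintype.card E : ℝ) / 30
          + ∑ W ∈ bad T, ((Finset.univ.filter fun e => src e ∈ W.1 ∨ dst e ∈ W.2).card : ℝ)) ∧
    (∑ T, ∑ W ∈ bad T, ((Finset.univ.filter fun e => src e ∈ W.1 ∨ dst e ∈ W.2).card : ℝ)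
        ≤ 2 ^ m * (4 * ((V₁.card : ℝ) + V₂.card) * ((Lₙ : ℝ) ^ 10)⁻¹)) := by
  classical
  obtain ⟨Es, hEs⟩ : ∃ Es : α → β → Prop, Es = fun i k => ∃ e, src e = i ∧ dst e = k := ⟨_, rfl⟩
  have hG : ∀ e, (bipGraph Es).Adj (Sum.inl (src e)) (Sum.inr (dst e)) := fun e =>
    (bipGraph_adj_inl_inr Es _ _).2 (by rw [hEs]; exact ⟨e, rfl, rfl⟩)
  have hsub : ∀ T, bad T ⊆ 𝒲 := fun T W hW => ((hbad T W).1 hW).1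
  have hbad' : ∀ T W, W ∈ bad T →
      γ' * Real.sqrt ((W.1.card : ℝ) * (W.2.card : ℝ)) < |∑ i ∈ W.1, ∑ k ∈ W.2, M T i k| :=
    fun T W hW => ((hbad T W).1 hW).2
  refine ⟨?_, ?_⟩
  · ----------------------------------------------------------------
    -- Prop. 9 with `B = ⋃ bad`
    ----------------------------------------------------------------
    intro T σ φ hσ hφ
    have hs : ∀ e : E, |((boolSign (T (out e)) : ℤ) : ℝ)| ≤ 1 := fun e => by
      rcases boolSign_eq_one_or (T (out e)) with h | h <;> simp [h]
    suffices hbadT : ∀ (W₁ : Finset α) (W₂ : Finset β),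
        ((bipGraph Es).induce {x | Sum.elim (fun i => i ∈ W₁) (fun j => j ∈ W₂) x}).Connected →
        γ' * Real.sqrt ((W₁.card : ℝ) * (W₂.card : ℝ)) < |∑ i ∈ W₁, ∑ k ∈ W₂, M T i k| →
        (W₁, W₂) ∈ bad T by
      have h1 := spot_cut_lt_of_dense src dst V₁ V₂ hE (fun e => ((boolSign (T (out e)) : ℤ) : ℝ)) hs
        (M T) (hM T) (bipGraph Es) hG hγ' ((bad T).biUnion Prod.fst) ((bad T).biUnion Prod.snd)
        (fun W₁ W₂ hd₁ hd₂ hconn => good_of_disjoint_bad (bipGraph Es) (M T) (bad T) hbadT W₁ W₂ hd₁ hd₂ hconn)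
        hdense σ φ hσ hφ
      have h2 : ((Finset.univ.filter fun e =>
            src e ∈ (bad T).biUnion Prod.fst ∨ dst e ∈ (bad T).biUnion Prod.snd).card : ℝ)
          ≤ ∑ W ∈ bad T, ((Finset.univ.filter fun e => src e ∈ W.1 ∨ dst e ∈ W.2).card : ℝ) := by
        exact_mod_cast card_meeting_bad_le_hatE src dst (bad T)
      linarith
    intro W₁ W₂ hconn hdisc
    have hne₁ : W₁.Nonempty := by
      rw [Finset.nonempty_iff_ne_empty]; rintro rfl
      simp only [Finset.sum_empty, abs_zero, Finset.card_empty, Nat.cast_zero, zero_mul,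
        Real.sqrt_zero, mul_zero, lt_self_iff_false] at hdisc
    have hne₂ : W₂.Nonempty := by
      rw [Finset.nonempty_iff_ne_empty]; rintro rfl
      simp only [Finset.sum_empty, Finset.sum_const_zero, abs_zero, Finset.card_empty, Nat.cast_zero,
        mul_zero, Real.sqrt_zero, lt_self_iff_false] at hdisc
    obtain ⟨i₀, hi₀⟩ := hne₁
    obtain ⟨k₀, hk₀⟩ := hne₂
    have hX : ∀ x, x ∈ ({x | Sum.elim (fun i => i ∈ W₁) (fun j => j ∈ W₂) x} : Set (α ⊕ β)) →
        Sum.elim (fun i => i ∈ V₁) (fun j => j ∈ V₂) x := by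
      intro x hx
      obtain ⟨y, hy, hxy⟩ : ∃ y, y ∈ ({x | Sum.elim (fun i => i ∈ W₁) (fun j => j ∈ W₂) x} :
          Set (α ⊕ β)) ∧ x ≠ y := by
        by_cases h : x = Sum.inl i₀
        · exact ⟨Sum.inr k₀, by simpa using hk₀, by rw [h]; exact Sum.inl_ne_inr⟩
        · exact ⟨Sum.inl i₀, by simpa using hi₀, h⟩
      obtain ⟨z, _, hxz⟩ := exists_adj_of_connected_induce (bipGraph Es) _ hconn hx hy hxy
      cases x with
      | inl i =>
        cases z with
        | inl i' => exact absurd hxz (bipGraph_not_adj_inl_inl _ _ _)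
        | inr k =>
          have h' := (bipGraph_adj_inl_inr Es _ _).1 hxz
          rw [hEs] at h'
          obtain ⟨e, he1, _⟩ := h'
          simp only [Sum.elim_inl]; rw [← he1]; exact (hE e).1
      | inr k =>
        cases z with
        | inr k' => exact absurd hxz (bipGraph_not_adj_inr_inr _ _ _)
        | inl i =>
          have h' := (bipGraph_adj_inr_inl Es _ _).1 hxz
          rw [hEs] at h'
          obtain ⟨e, _, he2⟩ := h'
          simp only [Sum.elim_inr]; rw [← he2]; exact (hE e).2
    have hW₁ : W₁ ⊆ V₁ := fun i hi => by simpa using hX (Sum.inl i) (by simpa using hi)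
    have hW₂ : W₂ ⊆ V₂ := fun k hk => by simpa using hX (Sum.inr k) (by simpa using hk)
    have hconn' : IsConnectedPair Es W₁ W₂ := by
      unfold IsConnectedPair
      rw [coe_disjSum_eq_setOf]; exact hconn
    rw [hbad, h𝒲]
    refine ⟨⟨hW₁, hW₂, ?_⟩, hdisc⟩
    rw [hEs] at hconn'; exact hconn'
  · ----------------------------------------------------------------
    -- Lemma 10 + counting + numerics
    ----------------------------------------------------------------
    have h1 := sum_hatE_le src dst out M hM hout hLₙ hdeg₁ hdeg₂ hγ' bad 𝒲 hsub hbad'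
    have h2 : ∑ W ∈ 𝒲, ((Finset.univ.filter fun e => src e ∈ W.1 ∨ dst e ∈ W.2).card : ℝ)
          * Real.exp (-(γ' ^ 2 * ((W.1.card : ℝ) + W.2.card) / (12 * Lₙ)))
        ≤ ∑ W ∈ 𝒲, ((Lₙ : ℝ) * ((W.1.card : ℝ) + W.2.card))
          * Real.exp (-(γ' ^ 2 * ((W.1.card : ℝ) + W.2.card) / (12 * Lₙ))) := by
      refine Finset.sum_le_sum fun W _ => mul_le_mul_of_nonneg_right ?_ (Real.exp_pos _).le
      exact_mod_cast card_meeting_le src dst hdeg₁ hdeg₂ W.1 W.2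
    have hV0 : (0 : ℝ) ≤ (V₁.card : ℝ) + V₂.card := add_nonneg (Nat.cast_nonneg _) (Nat.cast_nonneg _)
    have hcount : ∀ k, ((𝒲.filter fun W => W.1.card + W.2.card = k).card : ℝ)
        ≤ ((V₁.card : ℝ) + V₂.card) * (Lₙ : ℝ) ^ (2 * (k - 1)) := by
      intro k
      refine card_spotPairs_le src dst V₁ V₂ hdeg₁ hdeg₂ k _ fun W hW => ?_
      rw [Finset.mem_filter, h𝒲] at hW
      exact ⟨hW.1.1, hW.1.2.1, hW.1.2.2, hW.2⟩
    have h3 := hatE_weight_sum_le 𝒲 hV0 hLₙ2 hγ'L hcount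
    have hLₙ0 : (0 : ℝ) < Lₙ := by exact_mod_cast hLₙ
    have h2m : (0 : ℝ) ≤ 2 * 2 ^ m := by
      have : (0 : ℝ) ≤ 2 ^ m := pow_nonneg (by norm_num) m
      linarith
    calc ∑ T, ∑ W ∈ bad T, ((Finset.univ.filter fun e => src e ∈ W.1 ∨ dst e ∈ W.2).card : ℝ)
        ≤ 2 * 2 ^ m * ∑ W ∈ 𝒲, ((Finset.univ.filter fun e => src e ∈ W.1 ∨ dst e ∈ W.2).card : ℝ)
            * Real.exp (-(γ' ^ 2 * ((W.1.card : ℝ) + W.2.card) / (12 * Lₙ))) := h1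
      _ ≤ 2 * 2 ^ m * (((V₁.card : ℝ) + V₂.card) * ((Lₙ : ℝ) * (2 * ((Lₙ : ℝ) ^ 11)⁻¹))) :=
          mul_le_mul_of_nonneg_left (h2.trans h3) h2m
      _ = 2 ^ m * (4 * ((V₁.card : ℝ) + V₂.card) * ((Lₙ : ℝ) * ((Lₙ : ℝ) ^ 11)⁻¹)) := by ring
      _ = 2 ^ m * (4 * ((V₁.card : ℝ) + V₂.card) * ((Lₙ : ℝ) ^ 10)⁻¹) := by
          have : (Lₙ : ℝ) * ((Lₙ : ℝ) ^ 11)⁻¹ = ((Lₙ : ℝ) ^ 10)⁻¹ := by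
            field_simp
          rw [this]

/-- **REMAINDER PACKAGE, PARAMETRIC FORM** (free half-exponent `k`, size exponent `b`, threshold `t₀`;
rational radius `2^60/20` in place of `ρ_R`). -/
theorem remainder_package_param {α β E : Type} [Fintype α] [Fintype β] [DecidableEq α] [DecidableEq β]
    [Fintype E] {m n : ℕ} (src : E → α) (dst : E → β) (out : E → Fin m)
    (hout : ∀ j : Fin m, (Finset.univ.filter fun e => out e = j).card ≤ 3)
    (hdeg₁ : ∀ i, (Finset.univ.filter fun e => src e = i).card ≤ 2 ^ 60)
    (hdeg₂ : ∀ k, (Finset.univ.filter fun e => dst e = k).card ≤ 2 ^ 60)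
    (G : SimpleGraph (α ⊕ β)) [DecidableRel G.Adj] (hG : ∀ e, G.Adj (Sum.inl (src e)) (Sum.inr (dst e)))
    (hGdeg : ∀ x, G.degree x ≤ 2 ^ 60)
    (hn : 1 ≤ n) (hm : 2 ^ 60 * n ≤ m)
    (hN1 : 1 ≤ Fintype.card α + Fintype.card β)
    (hN : ((Fintype.card α : ℝ) + Fintype.card β) ≤ 2 * n + 1 + 6 * m / 2 ^ 60)
    (k b t₀ : ℕ) (hb : ((Fintype.card α : ℝ) + Fintype.card β) ≤ 2 ^ b)
    (ht : 2 * k + 2 * b ≤ 10 * (t₀ + 1)) (hk : 20 * ((Fintype.card α : ℝ) + Fintype.card β) ≤ 2 ^ k)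
    (hsparse : ∀ (W₁ : Finset α) (W₂ : Finset β),
      (G.induce {x | Sum.elim (fun i => i ∈ W₁) (fun j => j ∈ W₂) x}).Connected →
      W₁.card + W₂.card ≤ t₀ →
      ((Finset.univ.filter fun e => src e ∈ W₁ ∧ dst e ∈ W₂).card : ℝ)
        ≤ (60 * Real.sqrt (6000 * 2 ^ 60)) * Real.sqrt ((W₁.card : ℝ) * (W₂.card : ℝ)))
    (M : (Fin m → Bool) → Matrix α β ℝ)
    (hM : ∀ T i k, M T i k = ∑ e ∈ Finset.univ.filter (fun e => src e = i ∧ dst e = k),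
      ((boolSign (T (out e)) : ℤ) : ℝ)) :
    10 * (((Fintype.card α : ℝ) + Fintype.card β) * ((2 : ℝ) ^ 60 / 20) ^ (2 * k) + 1)
        ≤ (Real.sqrt 2 * ((2 : ℝ) ^ 60 / 20)) ^ (2 * k) ∧
      (∑ T : Fin m → Bool, ((Matrix.fromBlocks (0 : Matrix α α ℝ) (M T) (M T)ᵀ (0 : Matrix β β ℝ))
          ^ (2 * k)).trace
        ≤ 2 ^ m * (10 * (((Fintype.card α : ℝ) + Fintype.card β) * ((2 : ℝ) ^ 60 / 20) ^ (2 * k) + 1)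
            / 10)) ∧
      ((Fintype.card α : ℝ) + Fintype.card β) * (Real.sqrt 2 * ((2 : ℝ) ^ 60 / 20)) / 2 ≤ 0.32 * m := by
  classical
  set N : ℕ := Fintype.card α + Fintype.card β with hNdef
  have hNreal : (N : ℝ) = (Fintype.card α : ℝ) + Fintype.card β := by rw [hNdef]; push_cast; ring
  have hL2 : (2 : ℝ) ≤ (2 : ℝ) ^ 60 := by norm_num
  have hL0 : (0 : ℝ) < (2 : ℝ) ^ 60 := by positivity
  have hγ'0 : 0 ≤ Real.sqrt (6000 * 2 ^ 60) := Real.sqrt_nonneg _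
  have hγ'L := sfmBl_gamma'_sq_ge
  have hγγ := sfmBl_gamma'_le_gammasp
  have hγsp0 : 0 < 60 * Real.sqrt (6000 * 2 ^ 60) := lt_of_lt_of_le (by norm_num) sfmBl_two_le_gammasp
  have hγspL := sfmBl_gammasp_le_L
  have hρL := sfmBl_rho_le
  have hρ1 := sfmBl_one_le_rho
  set ρ : ℝ := 100 * ((60 * Real.sqrt (6000 * 2 ^ 60))
      * (Real.logb 2 ((2 : ℝ) ^ 60 / (60 * Real.sqrt (6000 * 2 ^ 60))) + 1)) with hρdef
  have hρρ' : ρ ≤ (2 : ℝ) ^ 60 / 20 := by rw [hρdef]; linarith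
  have hρ1' : 1 ≤ ρ := by rw [hρdef]; linarith
  have hρ0 : 0 ≤ ρ := by linarith
  have hρ'0 : (0 : ℝ) ≤ (2 : ℝ) ^ 60 / 20 := by positivity
  have hρ'1 : (1 : ℝ) ≤ (2 : ℝ) ^ 60 / 20 := by norm_num
  -- Prop. 7 in the leg model (with the true `ρ`)
  have hL₀ : ((2 ^ 60 : ℕ) : ℝ) ≤ (2 : ℝ) ^ 60 := by norm_num
  have h7 := sum_trace_pow_le_legs src dst out hout hdeg₁ hdeg₂ hL2 hL₀ G hG hGdeg hL₀ hγ'0 hγ'L hγγ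
    hγsp0 hγspL t₀ hsparse M hM k
  rw [← hρdef] at h7
  have hN0 : (0 : ℝ) ≤ N := Nat.cast_nonneg _
  have hb' : (N : ℝ) ≤ 2 ^ b := by rw [hNreal]; exact hb
  have hjunk := four_N_sq_pow_mul_inv_le_one hL2 hN0 hb' ht
  have hk' : 20 * (N : ℝ) ≤ 2 ^ k := by rw [hNreal]; exact hk
  have h20 := twenty_N_pow_le hρ'0 hk'
  -- `ρ^{2k} ≤ ρ'^{2k}`
  have hpow : ρ ^ (2 * k) ≤ ((2 : ℝ) ^ 60 / 20) ^ (2 * k) := pow_le_pow_left₀ hρ0 hρρ' _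
  refine ⟨?_, ?_, ?_⟩
  · rw [← hNreal]
    have hN1' : (1 : ℝ) ≤ N := by exact_mod_cast hN1
    have hNρ : 1 ≤ (N : ℝ) * ((2 : ℝ) ^ 60 / 20) ^ (2 * k) := by
      have : (1 : ℝ) ≤ ((2 : ℝ) ^ 60 / 20) ^ (2 * k) := one_le_pow₀ hρ'1
      nlinarith
    linarith
  · rw [← hNreal]
    refine h7.trans ?_
    rw [← hNreal]
    have h2m : (0 : ℝ) ≤ 2 ^ m := pow_nonneg (by norm_num) m
    have hj2 := mul_le_mul_of_nonneg_left hjunk h2m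
    have hmono : (2 : ℝ) ^ m * ((N : ℝ) * ρ ^ (2 * k)) ≤ 2 ^ m * ((N : ℝ) * ((2 : ℝ) ^ 60 / 20) ^ (2 * k)) :=
      mul_le_mul_of_nonneg_left (mul_le_mul_of_nonneg_left hpow hN0) h2m
    have e : (2 : ℝ) ^ m * (10 * ((N : ℝ) * ((2 : ℝ) ^ 60 / 20) ^ (2 * k) + 1) / 10)
        = 2 ^ m * ((N : ℝ) * ((2 : ℝ) ^ 60 / 20) ^ (2 * k)) + 2 ^ m * 1 := by ring
    rw [e]
    linarith
  · have hn' : (2 : ℝ) ^ 60 * n ≤ m := by exact_mod_cast hm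
    rw [← hNreal]
    exact remainder_budget_le hL0 hn hn' (le_refl _) hN0 (by rw [hNreal]; exact hN)

end Summit.PneNP.PneNP.Theorems.SfmBl
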